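import Summits.QuantumFields.YangMills.Theorems.BalabanUVNodesN08AlphaEq324RowACEnd
import Summits.QuantumFields.YangMills.Theorems.BalabanUVNodesN08SlotOfRecordFromAlphaACMassBound

/-!
# Route «BalabanUVNodes», Track-A DAG node N08 = [Balaban1985UV3] Thm 1 p. 257 ∕ Thm 2 p. 272 — THE (α)-SCHEMA CURRENCY MISMATCH #3 ON THE ROAD OF RECORD, part 3:
# the junction of the source-faithful (α)-AC edition (`…N08AlphaEq324RowAC(End)`: the [B1] (3.24) row as the printed sandwich `Eq324` at an arbitrary cumulant letter,
# range-honest bundle) with dag-n08-w1 g3's PRICED LOAD POINT OF E6′ (`…N08SlotOfRecordFromAlphaACMassBound`, p606479: row B25 at the AC tower from an EXTENSIVE MASS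
# BOUND `m_k(h,U) ≤ exp(c_m·|T₁^{(k)}|)`, the family constant re-booked `d ↦ d + c_m`) — N08's slot of record from the edition + the mass bound, no E6′, no tilted
# cgf-derivative bound

Cell `pub-ymgap`, seat `pub-ymgap-dag-n08-w4` gen 3 (INTENT-3; sequel of p607065 ∕ p608282).  `bears_on: R4∕N08`; filed `--supports stmt-QuantumFields-20542` (K1⁷, helper).
THEOREMS ONLY (def-free), sorry-free, standard axioms; p606479's generic `lf_towerAC3_of_massBound` and p605761's `printedUV3G_of_analyticLeaves_towerAC3_of_window` consumed
BY NAME; nothing of the lane re-declared.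

WHAT THIS FILE PROVES (each proof = the corresponding proof of p606479 §2–§4 with `RunAlphaAC ↦ RunAlphaEq324CoreLTAtAC … c` — the edition carries the B25 displays (67)∘LF
and (68) verbatim, which is all §1 of p606479 reads of the (α) clause — and part 2's leaves for every other row of the bundle):
* §1 ★★ `lf_towerOfAC_of_coreLTAtAC_of_massBound` — row B25 at `towerOfAC 𝔠.lane X 𝔖` on the `≤`-family from the edition's `hLF67`∕`h68` + `hmass`, exponent `(d + c_m)|T₁^{(k)}|`;
  ★★ `nonempty_analyticLeaves_towerOfAC_of_coreLTAtAC_of_massBound` — the WHOLE analytic bundle at the re-booked constants `C′ = {𝔠.lane.consts with d := d + c_m}`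
  (part 2's `stepResidualsAC_of_coreLTAtAC` ∕ `bound46_towerOfAC_of_coreLTAtAC` ∕ `bound25_vac_coreLTAtAC` for every other leaf).
* §2 ★★★ `printedUV3G_at_record_of_coreLTAtAC_of_massBound_of_window`, `printedUV3V_at_slotOfRecord_of_coreLTAtAC_of_massBound_of_consts`,
  `printedUV3V'_at_record_of_coreLTAtAC_of_massBound_of_consts`, and the A6 form `printedUV3V_at_slotOfRecord_of_coreLTAtAC_of_massBound_of_consts'` (inputs along
  `exists_externalInputsAC_ofPrint`; the mass bound stated X-FREE on print's own iterated Radon–Nikodym masses `MassesAC.massRecAC … (avOfPrint N S)`):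
  **`Node00.PrintedUV3V N L` ⟸ (on `Family L (eps0Of γ₀)`) the (α)-AC rows WITH THE (3.24) ROW IN PRINT'S OUTPUT-SANDWICH CURRENCY AT ANY CUMULANT LETTER over the range-honest
  bundle ∧ «`m_k(h,U) ≤ exp(c_m|T₁^{(k)}|)`, `1 ≤ k ≤ K`» ∧ `b₀p₀^{p₀}e^{1−p₀} ≤ εbg`**; `…_via_eq324`: p606479's own END recovered as the χ-letter instance (part 1's
  `coreLTAtAC_cum_of_runAlphaAC`).
LOCATED READING (R-AC-324 ∘ R4⁗) (count-neutral; owners decide): N08's residual list on the road of record now reads — (i) the (3.24) row as a SANDWICH `Eq324` at the letter a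
supplier speaks (for a [BenfattoEtAl1978]∕class supplier: the FREE Gaussian moment-cumulants, plugged by gen 2's `…RowCumLetterModel.h324RowAt_freeLetter_of_map` under a
presentation of B10's step block — the IDENT, class II ∕ NODE 00), (ii) the remaining (α)-AC rows (G3D-01…08 «as cited», (26), (28), (44), R3D-01∕02 at the AC objects), (iii) an
extensive a.e.-type mass bound in place of E6′ (p606479's two-part VERSION CAVEAT applies verbatim: analysis = a `dV`-a.e. bound for [Balaban1985Averaging] (15)'s transports;
bookkeeping = a capped AC mass carrier), (iv) `b₀p₀^{p₀}e^{1−p₀} ≤ εbg`.  Neither (i)'s supplier nor (iii) is claimed here.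
HONEST FRAMING: count-neutral helper; hypothesis-shape bookkeeping; nothing of [Balaban1985UV3] asserted or discharged; `PrintedUV3V` NOT proved; N08 NOT discharged; counts
unmoved; one finite 𝕋⁴ programme at fixed ε, Bałaban AS PRINTED (d = 3 tori of [B10] inside the record) — R4 closes the conditional finite-𝕋⁴ rung `BalabanLadder.UV` only; the
Yang–Mills mass gap (Clay) is NOT proved by any of this; nothing continuum ∕ ℝ⁴ ∕ OS.

References: [Balaban1985UV3] T. Bałaban, Commun. Math. Phys. 102 (1985) 255–275 — Thm 1 p. 257, Thm 2 p. 272, (7) p. 257, (39)–(41) p. 266, (67)–(71) pp. 273–274;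
[Balaban1985Averaging] T. Bałaban, Commun. Math. Phys. 98 (1985) 17–51 — (15) p. 19; [Balaban1982Higgs1] (3.24) p. 616; [BenfattoEtAl1978] Lemma p. 152.
-/

noncomputable section

namespace Summit.QuantumFields.YangMills.Theorems.BalabanUVNodesN08AlphaEq324RowACMassBound

open scoped Matrix.Norms.L2Operator
open Literature.MathematicalPhysics.QuantumFieldTheory.Balaban1983to89
open Literature.MathematicalPhysics.QuantumFieldTheory.Balaban1983to89.B10 (TowerRun pFun)
open Literature.MathematicalPhysics.QuantumFieldTheory.Balaban1983to89.Node00 (SU TFamily₃)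
open Literature.MathematicalPhysics.QuantumFieldTheory.Balaban1983to89.B10RunsOfRecord
open Literature.MathematicalPhysics.QuantumFieldTheory.Balaban1985CMP102
open Literature.MathematicalPhysics.QuantumFieldTheory.Balaban1985CMP102.Setting
open Literature.MathematicalPhysics.QuantumFieldTheory.Balaban1985CMP102.Theorems (Family)
open Summit.QuantumFields.Balaban3D
open Summit.QuantumFields.Balaban3D.Carriers (nblkOf StepSeries Hist HistWeights TowerInput rcolOf eps1Of epsSOf)
open Summit.QuantumFields.Balaban3D.Proofs
open Summit.QuantumFields.Balaban3D.Proofs.ScalesArithmetic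
open Summit.QuantumFields.Balaban3D.Proofs.Constants (eps0Of consts3_d_eq_log)
open Summit.QuantumFields.Balaban3D.Proofs.FamilyLE (le_of_eps0Of thresholds_of_le)
open Summit.QuantumFields.Balaban3D.Proofs.Family (prov_hb₁ prov_hb₂)
open Summit.QuantumFields.Balaban3D.Proofs.GroupModelLieC (lieC)
open Summit.QuantumFields.Balaban3D.Proofs.TowerAC (TowerInputAC LFAC)
open Summit.QuantumFields.Balaban3D.Proofs.StandardAC (ExternalInputsAC)
open Summit.QuantumFields.Balaban3D.Proofs.InputsAC (inputOfAC towerOfAC noInteraction0_towerOfAC)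
open Summit.QuantumFields.Balaban3D.Proofs.AlphaAC (AlphaDataAC RunAlphaAC)
open Summit.QuantumFields.Balaban3D.Proofs.AlphaAdaptersAC (logZT_le_piecesAC pprT_le_piecesAC)
open Summit.QuantumFields.Balaban3D.Proofs.Thm2AC (stepLeavesOfAC step0_towerOfAC)
open Summit.QuantumFields.Balaban3D.Proofs.Thresholds (gamma71L)
open Summit.QuantumFields.YangMills.BalabanUVNodes.N08Thm2AsPrintedAtSlotOfRecordAC (exists_TFamily₃_of_av_eq exists_externalInputsAC_ofPrint)
open Summit.QuantumFields.YangMills.BalabanUVNodes.N08Thm2AtRecordFromAlpha (window_of_famConsts pos_of_famConsts consts_adm_of_pos)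
open Summit.QuantumFields.YangMills.BalabanUVNodes.N08SlotOfRecordFromAlphaAC
open Summit.QuantumFields.YangMills.BalabanUVNodes.N08SlotOfRecordFromAlphaACMassBound (lf_towerAC3_of_massBound)
open Summit.QuantumFields.YangMills.Theorems.BalabanUVNodesN08AlphaEq324RowAC
open Summit.QuantumFields.YangMills.Theorems.BalabanUVNodesN08AlphaEq324RowACEnd

/-! ## §1 Row B25 and the analytic bundle at the re-booked constants from the edition + the mass bound, on the `≤`-family -/
section Lane

variable {L : ℕ} {S : Scales L} {G : Type} [GaugeGroup G] [MeasurableSpace G] [HaarData G] {𝔊 : GroupModel G} {𝔠 : Primitives.AlphaConsts L 𝔊.N}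
  {X : ExternalInputsAC S G} {𝔖 : ∀ k, StepSeries S G ↥(lieC 𝔊) (nblkOf S 𝔠.lane.carrier k) k} {𝔄 : AlphaDataLTAC 𝔊 𝔠 X 𝔖}
  {c : ∀ k, Hist S.P (k + 1) → GaugeField S.P (k + 1) G → ℕ → ℝ}
  (hle : S.g ^ 2 * S.ε₀ ≤ (min 𝔠.gamma0 1) ^ 2)
include hle

/-- ★★ **ROW B25 AT THE LANE'S AC TOWER FROM THE EDITED (α)-AC CLAUSE AND THE MASS BOUND, on the `≤`-family** — p606479's `lf_towerOfAC_of_alphaAC_of_massBound` with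
`RunAlphaAC ↦ RunAlphaEq324CoreLTAtAC … c` (its proof reads the (α) clause only through the B25 displays `hLF67`∕`h68`, carried verbatim by the edition); every hypothesis about
the lane's DEFINITIONS discharged as there. [cite: Balaban1985UV3, pp.273–274 + (67)–(68) p.273 + (39)–(41) p.266 + (7) p.257] -/
theorem lf_towerOfAC_of_coreLTAtAC_of_massBound (R : RunAlphaEq324CoreLTAtAC 𝔊 𝔠 X 𝔖 𝔄 c) {cm : ℝ} (hcm : 0 ≤ cm)
    (hmass : ∀ k, 1 ≤ k → k ≤ S.K → ∀ (h : Hist S.P k) (U : GaugeField S.P k G),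
      (inputOfAC 𝔠.lane X 𝔖).W.mass k h U ≤ Real.exp (cm * S.sites k)) :
    ∀ k, k ≤ (towerOfAC 𝔠.lane X 𝔖).K → ∀ U : (towerOfAC 𝔠.lane X 𝔖).Cfg k,
      (towerOfAC 𝔠.lane X 𝔖).LF k U (fun h => -((towerOfAC 𝔠.lane X 𝔖).mainT k h U) + (towerOfAC 𝔠.lane X 𝔖).Zterm k h)
        ≤ Real.exp ((𝔠.lane.consts.d + cm) * (towerOfAC 𝔠.lane X 𝔖).sites k) := by
  have hr₀ : 0 ≤ 𝔠.lane.carrier.r₀ := le_trans zero_le_one 𝔠.one_le_r₀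
  have hCz : 0 ≤ 𝔠.lane.carrier.Cz + 𝔠.lane.carrier.Cv := add_nonneg 𝔠.Cz_nonneg 𝔠.Cv_nonneg
  have hc₁ : 0 ≤ 𝔠.lane.carrier.c₁ := by show (0 : ℝ) ≤ 3; norm_num
  have hA : 0 ≤ (𝔠.lane.carrier.Cz + 𝔠.lane.carrier.Cv) + 𝔠.lane.carrier.C₅ + 𝔠.lane.carrier.C₆ +
      (|𝔠.lane.carrier.logσ₀| + 𝔠.lane.carrier.dg) * 𝔠.lane.carrier.c₁ := by
    have := 𝔠.lane.carrier.dg_nonneg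
    have := abs_nonneg 𝔠.lane.carrier.logσ₀
    have h5 : 0 ≤ 𝔠.lane.carrier.C₅ := 𝔠.C₅_nonneg
    have h6 : 0 ≤ 𝔠.lane.carrier.C₆ := 𝔠.C₆_nonneg
    positivity
  have hρ : (0 : ℝ) ≤ (𝔠.lane.carrier.R₁ + 1) * 𝔠.lane.carrier.M₁ := by
    have : 0 ≤ 𝔠.lane.carrier.R₁ := 𝔠.R₁_nonneg
    positivity
  exact lf_towerAC3_of_massBound 𝔊 𝔠.lane.consts (consts3_d_eq_log 𝔠.lane.F 𝔠.lane.sc) rfl S.hL.2 (inputOfAC 𝔠.lane X 𝔖) (gs := 1) (ε := S.g0sq)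
    (fun k hk => by exact_mod_cast sites_eq_card S k (by omega))
    (fun k h U hh => StandardAC.stdTowerInputAC_mass_eq_zero_of_not_admissible X 𝔠.lane.carrier 𝔖 k h U hh)
    hcm hmass (g0sq_pos S) 𝔠.C68_pos 𝔠.lane.F.b₀_pos 𝔠.lane.F.p₀_pos
    (fun j => by rw [show 𝔠.lane.consts.g = 1 from rfl, show 𝔠.lane.consts.L = (L : ℝ) from rfl]; exact gk_eq_gRun_norm S j)
    (fun j hj => (thresholds_of_le hle j hj.le).2.2.2.1) R.hLF67 R.h68 𝔠.lane.F.M₁_pos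
    (LargeFieldStd.rcolOf_antitone 𝔠.lane.carrier 𝔠.R₁_nonneg hr₀) hρ hr₀ (LargeFieldStd.rcolOf_le 𝔠.lane.carrier 𝔠.R₁_nonneg hr₀)
    (LargeFieldStd.zcoefOf_nonneg 𝔠.lane.carrier hCz 𝔠.C₅_nonneg 𝔠.C₆_nonneg hc₁)
    (LargeFieldStd.zcoefOf_le 𝔠.lane.carrier hCz 𝔠.C₅_nonneg 𝔠.C₆_nonneg hc₁) hA
    (fun j hj => ⟨gk_pos S j, gk_le_one S S.gK_le_one j hj⟩) le_rfl 𝔠.prov_r₀p₀ (prov_hb₁ 𝔠 𝔊.N_pos) (prov_hb₂ 𝔠 𝔊.N_pos)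

/-- ★★ **THE ANALYTIC BUNDLE AT THE AC TOWER AT THE RE-BOOKED CONSTANTS `C′ = {𝔠.lane.consts with d := d + c_m}` FROM THE EDITED (α)-AC CLAUSE AND THE MASS BOUND** (every
leaf but B25 as in part 2's `nonempty_analyticLeaves_towerOfAC_of_coreLTAtAC_of_lf` — `C′` agrees with the record on `C46, z, aP, σmax, dg, κ₀`; B25 from
`lf_towerOfAC_of_coreLTAtAC_of_massBound`). [cite: Balaban1985UV3, pp.256–274 (the leaves) + (46) p.267 + (65) p.273 + pp.273–274] -/
theorem nonempty_analyticLeaves_towerOfAC_of_coreLTAtAC_of_massBound (R : RunAlphaEq324CoreLTAtAC 𝔊 𝔠 X 𝔖 𝔄 c) {cm : ℝ} (hcm : 0 ≤ cm)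
    (hmass : ∀ k, 1 ≤ k → k ≤ S.K → ∀ (h : Hist S.P k) (U : GaugeField S.P k G),
      (inputOfAC 𝔠.lane X 𝔖).W.mass k h U ≤ Real.exp (cm * S.sites k)) :
    Nonempty (UVStability3D.AnalyticLeaves { 𝔠.lane.consts with d := 𝔠.lane.consts.d + cm, d_nonneg := add_nonneg 𝔠.lane.consts.d_nonneg hcm } S (towerOfAC 𝔠.lane X 𝔖)) :=
  ⟨{ step0 := step0_towerOfAC 𝔠.lane X 𝔖
     noInt0 := noInteraction0_towerOfAC 𝔠.lane X 𝔖
     steps := fun k hk => stepLeavesOfAC k hk (stepResidualsAC_of_coreLTAtAC hle hk (R.steps k hk))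
     bound46 := bound46_towerOfAC_of_coreLTAtAC hle R
     logZT_le := fun k hk => logZT_le_piecesAC 𝔠.lane X 𝔖 k 𝔠.cT_pos rfl (R.steps k hk).logZT
     PprT_le := fun k hk => pprT_le_piecesAC 𝔠.lane X 𝔖 k hk (by linarith [𝔠.kappa_ge]) 𝔠.C25_nonneg rfl
       (bound25_vac_coreLTAtAC (R.steps k hk))
     lf := lf_towerOfAC_of_coreLTAtAC_of_massBound hle R hcm hmass
     starT_eq := fun _ _ => rfl
     logσ₀_le := fun _ _ => le_rfl
     dg_le := fun _ _ => le_rfl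
     rem_eq := fun _ _ => rfl }⟩

end Lane

/-! ## §2 The printed pair at the record's binders and THE SLOT OF RECORD from the edition + the mass bound — no E6′, no tilted cgf bound -/
section Slot

variable {N : ℕ} [NeZero N] {L : ℕ} {𝔊 : GroupModel (SU N)} {𝔠 : Primitives.AlphaConsts L 𝔊.N} {εbg cm : ℝ}
  {X : ∀ S : Scales L, ExternalInputsAC S (SU N)}
  {𝔖 : ∀ (S : Scales L) (k : ℕ), StepSeries S (SU N) ↥(lieC 𝔊) (nblkOf S 𝔠.lane.carrier k) k}
  {𝔄 : ∀ S : Scales L, AlphaDataLTAC 𝔊 𝔠 (X S) (𝔖 S)}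
  {c : ∀ (S : Scales L) (k : ℕ), Hist S.P (k + 1) → GaugeField S.P (k + 1) (SU N) → ℕ → ℝ}

/-- ★★★ **THE PRINTED PAIR `PrintedUV3G` AT THE RECORD'S BINDERS FROM THE EDITED (α)-AC ROWS AND THE MASS BOUND, GIVEN THE WINDOW** (p606479's
`printedUV3G_at_record_of_alphaAC_of_massBound_of_window` one (α)-currency lower: `RunAlphaEq324CoreLTAtAC … (c S)`; the family's constants are the re-booked `C′`, normalised and
used by the AC towers). [cite: Balaban1985UV3, Thm 1 p.257 + Thm 2 p.272 + pp.256–274] -/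
theorem printedUV3G_at_record_of_coreLTAtAC_of_massBound_of_window
    (hUk : ∀ (S : Scales L) k (V : GaugeField S.P (k + 1) (SU N)), (X S).Uk k V = UkA N (fun S => (X S).av) S (k + 1) εbg V) (hpos : 0 < εbg)
    (hwin : ∀ S : Family L (eps0Of 𝔠.gamma0), eps1OfPrint
        { eps0 := eps0Of 𝔠.gamma0, E := fun S => B10.Ek (inputOfAC 𝔠.lane (X S) (𝔖 S)).Estep S.K 0,
          b₀ := 𝔠.lane.F.b₀, p₀ := 𝔠.lane.F.p₀, εbg := εbg } S.1 0 ≤ εbg ∨ 2 < εbg)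
    (R : ∀ S : Family L (eps0Of 𝔠.gamma0), RunAlphaEq324CoreLTAtAC 𝔊 𝔠 (X S.1) (𝔖 S.1) (𝔄 S.1) (c S.1)) (hcm : 0 ≤ cm)
    (hmass : ∀ S : Family L (eps0Of 𝔠.gamma0), ∀ k, 1 ≤ k → k ≤ S.1.K → ∀ (h : Hist S.1.P k) (U : GaugeField S.1.P k (SU N)),
      (inputOfAC 𝔠.lane (X S.1) (𝔖 S.1)).W.mass k h U ≤ Real.exp (cm * S.1.sites k)) :
    PrintedUV3G N L (runObjects₀A N (fun S => (X S).av)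
      (fun S j => (Carriers.run3 ((inputOfAC 𝔠.lane (X S) (𝔖 S)).toRunInput fun _ => True)).T j) (Backgrounds.ofAvg N L fun S => (X S).av)) := by
  refine printedUV3G_of_analyticLeaves_towerAC3_of_window (fun S => inputOfAC 𝔠.lane (X S) (𝔖 S))
    { eps0 := eps0Of 𝔠.gamma0, E := fun S => B10.Ek (inputOfAC 𝔠.lane (X S) (𝔖 S)).Estep S.K 0,
      b₀ := 𝔠.lane.F.b₀, p₀ := 𝔠.lane.F.p₀, εbg := εbg }
    (consts_adm_of_pos 𝔠 hpos _) (fun _ _ => rfl) (fun S k V => hUk S k V) (fun _ => rfl) hwin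
    (C := { 𝔠.lane.consts with d := 𝔠.lane.consts.d + cm, d_nonneg := add_nonneg 𝔠.lane.consts.d_nonneg hcm }) 𝔠.lane.normalised (fun S => ?_)
    (fun S => nonempty_analyticLeaves_towerOfAC_of_coreLTAtAC_of_massBound (le_of_eps0Of S.1 S.2) (R S) hcm (hmass S))
  have u := usesConsts_inputOfAC 𝔠.lane (X S.1) (𝔖 S.1) fun _ => True
  exact ⟨u.M₁_eq, u.b₀_eq, u.p₀_eq, u.κ₀_eq, u.rcoef_eq, u.Λvol_nonneg⟩

/-- ★★★ **THE SLOT OF RECORD `Node00.PrintedUV3V N L` FROM THE EDITED (α)-AC ROWS AND THE MASS BOUND, `b₀p₀^{p₀}e^{1−p₀} ≤ εbg`** — AC inputs AT PRINT'S OWN AVERAGING pinned to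
the record; the (3.24) row in print's output-sandwich currency at any letter; NO E6′, no `εbg > 2`, no regime condition on `γ₀`.
[cite: Balaban1985UV3, Thm 1 p.257 + Thm 2 p.272 + (7) p.257; Balaban1985Averaging, (15) p.19] -/
theorem printedUV3V_at_slotOfRecord_of_coreLTAtAC_of_massBound_of_consts (hav : ∀ S, (X S).av = avOfPrint N S)
    (hUk : ∀ (S : Scales L) k (V : GaugeField S.P (k + 1) (SU N)), (X S).Uk k V = UkA N (fun S => (X S).av) S (k + 1) εbg V)
    (hε : 𝔠.lane.F.b₀ * (𝔠.lane.F.p₀ ^ 𝔠.lane.F.p₀ * Real.exp (1 - 𝔠.lane.F.p₀)) ≤ εbg)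
    (R : ∀ S : Family L (eps0Of 𝔠.gamma0), RunAlphaEq324CoreLTAtAC 𝔊 𝔠 (X S.1) (𝔖 S.1) (𝔄 S.1) (c S.1)) (hcm : 0 ≤ cm)
    (hmass : ∀ S : Family L (eps0Of 𝔠.gamma0), ∀ k, 1 ≤ k → k ≤ S.1.K → ∀ (h : Hist S.1.P k) (U : GaugeField S.1.P k (SU N)),
      (inputOfAC 𝔠.lane (X S.1) (𝔖 S.1)).W.mass k h U ≤ Real.exp (cm * S.1.sites k)) :
    Node00.PrintedUV3V N L := by
  obtain ⟨𝔗', h'⟩ := exists_TFamily₃_of_av_eq (N := N) (funext hav)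
    (fun S j => (Carriers.run3 ((inputOfAC 𝔠.lane (X S) (𝔖 S)).toRunInput fun _ => True)).T j)
  have hR : runObjects₀A N (fun S => (X S).av) (fun S j => (Carriers.run3 ((inputOfAC 𝔠.lane (X S) (𝔖 S)).toRunInput fun _ => True)).T j)
      (Backgrounds.ofAvg N L fun S => (X S).av) = runObjects₀T N 𝔗' (Backgrounds.ofPrint N L) :=
    funext fun c' => funext fun S => h' c' S
  exact ⟨𝔗', hR ▸ printedUV3G_at_record_of_coreLTAtAC_of_massBound_of_window (𝔄 := 𝔄) (c := c) hUk (pos_of_famConsts hε)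
    (fun S => window_of_famConsts hε _ S.1) R hcm hmass⟩

/-- ★★ **THE PRIMED SLOT `Node00.PrintedUV3V' N L` FROM THE EDITED (α)-AC ROWS AND THE MASS BOUND along an ADMISSIBLE AC averaging**, `b₀p₀^{p₀}e^{1−p₀} ≤ εbg`.
[cite: Balaban1985UV3, Thm 1 p.257 + Thm 2 p.272; Balaban1987RG1, (0.4)–(0.9) p.253] -/
theorem printedUV3V'_at_record_of_coreLTAtAC_of_massBound_of_consts (h𝔞 : Node00.AvgAdmissible₃ N fun S => (X S).av)
    (hUk : ∀ (S : Scales L) k (V : GaugeField S.P (k + 1) (SU N)), (X S).Uk k V = UkA N (fun S => (X S).av) S (k + 1) εbg V)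
    (hε : 𝔠.lane.F.b₀ * (𝔠.lane.F.p₀ ^ 𝔠.lane.F.p₀ * Real.exp (1 - 𝔠.lane.F.p₀)) ≤ εbg)
    (R : ∀ S : Family L (eps0Of 𝔠.gamma0), RunAlphaEq324CoreLTAtAC 𝔊 𝔠 (X S.1) (𝔖 S.1) (𝔄 S.1) (c S.1)) (hcm : 0 ≤ cm)
    (hmass : ∀ S : Family L (eps0Of 𝔠.gamma0), ∀ k, 1 ≤ k → k ≤ S.1.K → ∀ (h : Hist S.1.P k) (U : GaugeField S.1.P k (SU N)),
      (inputOfAC 𝔠.lane (X S.1) (𝔖 S.1)).W.mass k h U ≤ Real.exp (cm * S.1.sites k)) :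
    Node00.PrintedUV3V' N L :=
  ⟨fun S => (X S).av, h𝔞, fun S j => (Carriers.run3 ((inputOfAC 𝔠.lane (X S) (𝔖 S)).toRunInput fun _ => True)).T j,
    printedUV3G_at_record_of_coreLTAtAC_of_massBound_of_window (𝔄 := 𝔄) (c := c) hUk (pos_of_famConsts hε)
      (fun S => window_of_famConsts hε _ S.1) R hcm hmass⟩

variable (N L) in
/-- ★★★ **THE SLOT OF RECORD FROM ITS AC RESIDUALS IN PRINT'S (3.24) CURRENCY WITH THE MASS BOUND ON PRINT'S OWN MASSES — A6 FORM** (p605761's∕file 9's inhabitant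
`exists_externalInputsAC_ofPrint`; the lane's AC masses ARE print's iterated transports `MassesAC.massRecAC … (avOfPrint N S)` by `StandardAC.stdTowerInputAC_mass`): for every
`SU(N)`, `𝔠`, `εbg` with `b₀p₀^{p₀}e^{1−p₀} ≤ εbg` and `c_m ≥ 0`, THERE ARE print-averaging AC inputs `X` such that, for every expansion data `𝔖`, range-honest (α)-AC data `𝔄`
and cumulant letter `c`, **the edited (α)-AC rows (the (3.24) row as the printed sandwich `Eq324` at `c`) on the family ∧ «`massRecAC … (avOfPrint N S) k h U ≤ exp(c_m|T₁^{(k)}|)`,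
`1 ≤ k ≤ K`» ⇒ `Node00.PrintedUV3V N L`**.  p606479's VERSION CAVEAT on the pointwise `massRecAC` letter applies verbatim.
[cite: Balaban1985UV3, Thm 1 p.257 + Thm 2 p.272 + (41) p.266 + pp.273–274; Balaban1985Averaging, (15) p.19; Balaban1982Higgs1, (3.24) p.616] -/
theorem printedUV3V_at_slotOfRecord_of_coreLTAtAC_of_massBound_of_consts' (𝔊 : GroupModel (SU N)) (𝔠 : Primitives.AlphaConsts L 𝔊.N) (εbg cm : ℝ)
    (hε : 𝔠.lane.F.b₀ * (𝔠.lane.F.p₀ ^ 𝔠.lane.F.p₀ * Real.exp (1 - 𝔠.lane.F.p₀)) ≤ εbg) (hcm : 0 ≤ cm)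
    (hmass : ∀ S : Family L (eps0Of 𝔠.gamma0), ∀ k, 1 ≤ k → k ≤ S.1.K → ∀ (h : Hist S.1.P k) (U : GaugeField S.1.P k (SU N)),
      MassesAC.massRecAC 𝔠.lane.carrier.M₁ (rcolOf S.1 𝔠.lane.carrier) (eps1Of S.1 𝔠.lane.carrier) (epsSOf S.1 𝔠.lane.carrier) (avOfPrint N S.1) k h U ≤
        Real.exp (cm * S.1.sites k)) :
    ∃ X : ∀ S : Scales L, ExternalInputsAC S (SU N), (∀ S, (X S).av = avOfPrint N S) ∧
      ∀ (𝔖 : ∀ (S : Scales L) (k : ℕ), StepSeries S (SU N) ↥(lieC 𝔊) (nblkOf S 𝔠.lane.carrier k) k)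
        (𝔄 : ∀ S : Scales L, AlphaDataLTAC 𝔊 𝔠 (X S) (𝔖 S))
        (c : ∀ (S : Scales L) (k : ℕ), Hist S.P (k + 1) → GaugeField S.P (k + 1) (SU N) → ℕ → ℝ),
        (∀ S : Family L (eps0Of 𝔠.gamma0), RunAlphaEq324CoreLTAtAC 𝔊 𝔠 (X S.1) (𝔖 S.1) (𝔄 S.1) (c S.1)) → Node00.PrintedUV3V N L := by
  obtain ⟨X, hav, -, hUk⟩ := exists_externalInputsAC_ofPrint N L εbg
  refine ⟨X, hav, fun 𝔖 𝔄 c R => printedUV3V_at_slotOfRecord_of_coreLTAtAC_of_massBound_of_consts (𝔄 := 𝔄) (c := c) hav hUk hε R hcm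
    fun S k hk1 hkK h U => ?_⟩
  rw [show (inputOfAC 𝔠.lane (X S.1) (𝔖 S.1)).W.mass k h U = _ from StandardAC.stdTowerInputAC_mass (X S.1) 𝔠.lane.carrier (𝔖 S.1) k h U]
  have hX : (X S.1).av = avOfPrint N S.1 := hav S.1
  rw [hX]
  exact hmass S k hk1 hkK h U

/-- ★ **… AND (R4⁗) ITSELF IS THE χ-LETTER INSTANCE**: p606479's antecedent `RunAlphaAC` on the family gives this file's antecedent at the lane's letter `(𝔖 S ·).cum` over
`restrictLTAC` (part 1's `coreLTAtAC_cum_of_runAlphaAC`) — the slot of record from `RunAlphaAC` + the mass bound recovered as a one-line corollary.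
[cite: Balaban1985UV3, Thm 1 p.257 + Thm 2 p.272 (bookkeeping)] -/
theorem printedUV3V_at_slotOfRecord_of_alphaAC_of_massBound_of_consts_via_eq324 {𝔄' : ∀ S : Scales L, AlphaDataAC 𝔊 𝔠 (X S) (𝔖 S)}
    (hav : ∀ S, (X S).av = avOfPrint N S)
    (hUk : ∀ (S : Scales L) k (V : GaugeField S.P (k + 1) (SU N)), (X S).Uk k V = UkA N (fun S => (X S).av) S (k + 1) εbg V)
    (hε : 𝔠.lane.F.b₀ * (𝔠.lane.F.p₀ ^ 𝔠.lane.F.p₀ * Real.exp (1 - 𝔠.lane.F.p₀)) ≤ εbg)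
    (R : ∀ S : Family L (eps0Of 𝔠.gamma0), RunAlphaAC 𝔊 𝔠 (X S.1) (𝔖 S.1) (𝔄' S.1)) (hcm : 0 ≤ cm)
    (hmass : ∀ S : Family L (eps0Of 𝔠.gamma0), ∀ k, 1 ≤ k → k ≤ S.1.K → ∀ (h : Hist S.1.P k) (U : GaugeField S.1.P k (SU N)),
      (inputOfAC 𝔠.lane (X S.1) (𝔖 S.1)).W.mass k h U ≤ Real.exp (cm * S.1.sites k)) :
    Node00.PrintedUV3V N L :=
  printedUV3V_at_slotOfRecord_of_coreLTAtAC_of_massBound_of_consts (𝔄 := fun S => restrictLTAC (𝔄' S)) (c := fun S k => (𝔖 S k).cum) hav hUk hε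
    (fun S => coreLTAtAC_cum_of_runAlphaAC (R S)) hcm hmass

end Slot

end Summit.QuantumFields.YangMills.Theorems.BalabanUVNodesN08AlphaEq324RowACMassBound

end
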